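import Summits.QuantumFields.YangMills.Theorems.FluctuationComparisonRegPrIntLS2BetaGapFlatOfStabiliserLift
import Summits.QuantumFields.YangMills.Theorems.FluctuationComparisonRegPrIntLS2BetaCriticalOrbitUniqueAbelian
import HarnessLib

/-!
# S2β · TUBE♭ ∕ GAP♭ AT THE ABELIAN STRATUM — (T7c)∕(T7e) at every case-A (σ₃-diagonal-stabiliser) datum, modulo px12's ONE abelian letter EX^{ab}

Cell `ym3-torus` (YM ladder rung R3 = continuum `SU(2)` Yang–Mills on T³ at fixed lattice data — NOT d = 4, NOT infinite volume, NOT a mass gap, NOT Clay).  Width seat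
`ym3-torus-px17` (gen 16), FREE px helper of crux `stmt-QuantumFields-20520`; `--supports … --as helper`, count-neutral, DEFINITION-FREE (0 `def`∕`instance`∕`notation`, default heartbeats).

WHAT.  ✓`…S2BetaGapFlatOfStabiliserLift` (this seat, FILE 1) proves TUBE♭∕GAP♭ at print's regular minimiser `U₀` over EVERY datum `V` from the ONE token `hlift`(V,U₀)
(«every symmetry of `V` is the descent of a symmetry of `U₀`»).  ✓px12 g21 (B) FILE 3 `…S2BetaCriticalOrbitUniqueAbelian.symmetriesLift_at_critical_of_abelianMin_five` supplies that
token at EVERY R2-critical regular point over an ABELIAN datum (stabiliser = constant σ₃-diagonal transformations, `hStab`) modulo EX^{ab} («a σ₃-diagonal lettering `e^{a·iσ₃}`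
with strict loop-sum guards is regular and minimises the Wilson action among the σ₃-DIAGONAL members of `regFibrePr F n K e V`» — px12's letters VERBATIM).  THIS FILE composes:
* §1 ★★★ `tubeGrowth_at_abelianMin_of_hreg_five` — TUBE♭(V,U₀) at every abelian datum ⟸ {EX^{ab}, `hreg`(δ)};
* §2 ★★★★ `gapFlat_at_abelianMin_of_hreg_five` — GAP♭(V,U₀) ⟸ {EX^{ab}, `hreg`(δ)} UNIFORMLY in `γ ≤ γ*(L,b₀,p₀,δ)`; ★★★★ `gapFlat_at_abelianMin_five` — GAP♭(V,U₀) ⟸ EX^{ab} ALONE at a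
  per-base-point `γ ≤ γ*(U₀)`.
px12's admissibility rows `143·(49∕4)²·e ≤ 1∕3`, `2e ≤ 2δ₂∕(7L)²` are DISCHARGED into the threshold (✓px13 `exists_ePi`); the rows left displayed are EX^{ab}'s: the depth room
`K − n ≤ m + K_P`, `hStab`, the loop-sum guards, `e^{a·iσ₃} ∈ regFibrePr F n K e V`, the σ₃-diagonal minimality — and the base-point rows {`U₀ ∈ regFibrePr e V`, `A U₀ = minActionRegPr e V`}
(EXW∘'s).  With ✓(T7e) (irreducible stratum), RECORD 17gc (flat) and px12's FILE 4 (case B, central holonomy) the per-datum GAP♭ board reads: every stratum has a named inhabitant modulo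
its own existence letter.

HONEST: composition BY NAME; nothing of Bałaban's analysis beyond the cited tree theorems; EX^{ab}, `hStab` at general data, `hreg` at general δ, TUBE-REG∘'s uniform order (RECORD 17gh),
GAP♯∘, EXW∘, S2β, crux 20520 NOT proved; `L = 3` socket open (EMBARGO-LITE №58); no summit statement is proved by a helper; finite-volume ∕ conditional; rung R3 = SU(2) YM₃ on T³ —
NOT d = 4, NOT infinite volume, NOT a mass gap, NOT Clay; the Yang–Mills mass gap is NOT proved.  No `sorry`, axioms standard.

References: T. Bałaban, CMP **102** (1985) 277–309 [Balaban1985Variational] ((2)–(6) p.278, Thm 1 (8)–(10) p.279, Prop. 7 and (141)–(143) p.299); CMP **102** (1985) 255–275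
[Balaban1985UV3] ((12)–(13) p.259, (18)–(22) p.260); CMP **98** (1985) 17–51 [Balaban1985Averaging] ((11)–(13) p.19, Prop. 2 p.26); CMP **99** (1985) 75–102 [Balaban1985RegularSpaces]
(Lemma 1 p.79, Thm 2 p.83).
-/

set_option autoImplicit false

noncomputable section

namespace Summit.QuantumFields.YangMills.Theorems.FluctuationComparisonRegPrIntLS2BetaGapFlatAtAbelian

open Set Filter Topology Function
open scoped Matrix.Norms.L2Operator
open Literature.MathematicalPhysics.QuantumFieldTheory.Balaban1983to89
open Literature.MathematicalPhysics.QuantumFieldTheory.Balaban1983to89.T3ContinuumYM3Torus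
open Literature.MathematicalPhysics.QuantumFieldTheory.Balaban1983to89.T3UnitLawDensityEML (ℰp)
open Literature.MathematicalPhysics.QuantumFieldTheory.Balaban1983to89.T3UnitScaleTilt
open Literature.MathematicalPhysics.QuantumFieldTheory.Balaban1983to89.T3TiltDescent
open Literature.MathematicalPhysics.QuantumFieldTheory.Balaban1983to89.T3ConstrainedMinimiser (fibre)
open Literature.MathematicalPhysics.QuantumFieldTheory.Balaban1983to89.T3PrintedRegularMinimiser
open Literature.MathematicalPhysics.QuantumFieldTheory.Balaban1983to89.T3PrintedRegularOrbits (descTransf)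
open Literature.MathematicalPhysics.QuantumFieldTheory.Balaban1983to89.T3Thm1CarrierNative (IsCritR2 isCritR2_of_isMinOn)
open Literature.MathematicalPhysics.QuantumFieldTheory.Balaban1983to89.T4Continuum
open Literature.MathematicalPhysics.QuantumFieldTheory.Balaban1983to89.BlockAveraging (Idx)
open Literature.MathematicalPhysics.QuantumFieldTheory.Balaban1983to89.ExpMeanLog (deltaSU)
open Literature.MathematicalPhysics.QuantumFieldTheory.Balaban1983to89.B9AdOrthogonal (σ₃)
open scoped Literature.MathematicalPhysics.QuantumFieldTheory.Balaban1983to89.T3OrbitAverage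
open Summit.QuantumFields.Balaban3D.Carriers (suGroupModel)
open Summit.QuantumFields.YangMills.Theorems.AbelianEML (gexpAt linAvgIter loopSum)
open Summit.QuantumFields.YangMills.Theorems.Prop7SymCentreAbelianDict (I_smul_sigma3_mem_lie)
open Summit.QuantumFields.YangMills.Theorems.FluctuationComparisonRegPrIntLS2BetaDescentLipschitz (exists_ePi)
open Summit.QuantumFields.YangMills.Theorems.FluctuationComparisonRegPrIntLS2BetaGapFlatOfStabiliserLift
open Summit.QuantumFields.YangMills.Theorems.FluctuationComparisonRegPrIntLS2BetaCriticalOrbitUniqueAbelian (symmetriesLift_at_critical_of_abelianMin_five)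

/-! ## §1 TUBE♭ at the abelian stratum from EX^{ab} and the tube-regularity row -/

section Tube

/-- ★★★ **TUBE♭(V,U₀) AT PRINT'S REGULAR MINIMISER OVER AN ABELIAN DATUM ⟸ {EX^{ab}, `hreg`(δ)}.**  For every `L ≥ 5` there is `e₉ > 0` such that at every member
`(F, n < K)` with depth room `K − n ≤ m + K_P`, every `0 < e ≤ e₉`, every datum `V` with constant σ₃-diagonal stabiliser (`hStab`), every abelian lettering `a` with the strict
loop-sum guards whose `e^{a·iσ₃}` is regular and minimises the Wilson action among the σ₃-diagonal members of `regFibrePr F n K e V` (EX^{ab}, px12's letters VERBATIM), every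
`U₀ ∈ regFibrePr e V` realising `minActionRegPr e V`, and every tube radius `δ` with the tube-regularity row `hreg`(δ): TUBE♭(V,U₀) (text VERBATIM).
✓FILE 1 `tubeGrowth_at_isCritR2_of_lift_of_hreg_five` ∘ ✓px12 `symmetriesLift_at_critical_of_abelianMin_five`; px12's admissibility rows discharged by ✓`exists_ePi`.
[cite: Balaban1985Variational, (4)-(6) p.278, Thm 1 (8)-(10) p.279, Prop. 7 and (141)-(143) p.299; Balaban1985UV3, (12)-(13) p.259 and (18)-(22) p.260; Balaban1985Averaging, (11)-(13) p.19] -/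
theorem tubeGrowth_at_abelianMin_of_hreg_five (L : ℕ) (h5 : 5 ≤ L) :
    ∃ e₉ : ℝ, 0 < e₉ ∧ ∀ (F : T3Family), F.L = L → ∀ (n K : ℕ) (hnK : n < K), K - n ≤ (F.P K).m + (F.P K).K →
      ∀ (γ b₀ p₀ e : ℝ) (V : GaugeField (F.P n) 0 (Matrix.specialUnitaryGroup (Fin 2) ℂ)) (a : PBond (F.P K) 0 → ℝ),
      0 < e → e ≤ e₉ →
      (∀ s : GaugeTransf (F.P n) 0 (Matrix.specialUnitaryGroup (Fin 2) ℂ), GaugeField.gaugeAct s V = V →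
        ∃ c : Matrix.specialUnitaryGroup (Fin 2) ℂ, Commute ((c : Matrix.specialUnitaryGroup (Fin 2) ℂ) : Matrix (Fin 2) (Fin 2) ℂ) σ₃ ∧ s = fun _ => c) →
      (∀ s', s' < K - n → ∀ (c : PBond (F.P K) (s' + 1)) (i : Idx (F.P K)), 3 * |loopSum (linAvgIter s' a) c i| < 1) →
      gexpAt (suGroupModel 2) I_smul_sigma3_mem_lie a ∈ regFibrePr F n K hnK.le e V →
      (∀ W' : GaugeField (F.P K) 0 (Matrix.specialUnitaryGroup (Fin 2) ℂ),
        (∀ b, Commute ((W' b : Matrix.specialUnitaryGroup (Fin 2) ℂ) : Matrix (Fin 2) (Fin 2) ℂ) σ₃) → W' ∈ regFibrePr F n K hnK.le e V →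
          wilsonAction4 (gexpAt (suGroupModel 2) I_smul_sigma3_mem_lie a) ≤ wilsonAction4 W') →
      ∀ (U₀ : GaugeField (F.P K) 0 (Matrix.specialUnitaryGroup (Fin 2) ℂ)) (δ : ℝ), U₀ ∈ regFibrePr F n K hnK.le e V →
        wilsonAction4 U₀ = minActionRegPr F n K hnK.le e V →
        (∀ U ∈ closure (fibre F ℰp n K hnK.le V ∩ histGood F ℰp (θBal F.L γ b₀ p₀) K n),
            (∃ w : Site (F.P K) 0 → Matrix.specialUnitaryGroup (Fin 2) ℂ,
              (∀ U'' : GaugeField (F.P K) 0 (Matrix.specialUnitaryGroup (Fin 2) ℂ),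
                  descendTo F ℰp n K hnK.le (GaugeField.gaugeAct w U'') = descendTo F ℰp n K hnK.le U'') ∧
                ∀ ℓ : PBond (F.P K) 0, dist1 (U ℓ * ((GaugeField.gaugeAct w U₀) ℓ)⁻¹) ≤ δ) →
            wilsonAction4 U ≤ minActionRegPr F n K hnK.le e V → U ∈ regFibrePr F n K hnK.le e V) →
        ∃ μ : ℝ, 0 < μ ∧ ∀ U ∈ fibre F ℰp n K hnK.le V, U ∈ histGood F ℰp (θBal F.L γ b₀ p₀) K n →
          (∃ w : Site (F.P K) 0 → Matrix.specialUnitaryGroup (Fin 2) ℂ,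
              (∀ U'' : GaugeField (F.P K) 0 (Matrix.specialUnitaryGroup (Fin 2) ℂ),
                  descendTo F ℰp n K hnK.le (GaugeField.gaugeAct w U'') = descendTo F ℰp n K hnK.le U'') ∧
                ∀ ℓ : PBond (F.P K) 0, dist1 (U ℓ * ((GaugeField.gaugeAct w U₀) ℓ)⁻¹) ≤ δ) →
          μ * ((F.L : ℝ)⁻¹) ^ (2 * (K - n)) *
              (⨅ w : {w : Site (F.P K) 0 → Matrix.specialUnitaryGroup (Fin 2) ℂ |
                  ∀ U : GaugeField (F.P K) 0 (Matrix.specialUnitaryGroup (Fin 2) ℂ),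
                    descendTo F ℰp n K hnK.le (GaugeField.gaugeAct w U) = descendTo F ℰp n K hnK.le U},
                ∑ ℓ : PBond (F.P K) 0,
                  dist1 (U ℓ * ((GaugeField.gaugeAct (w : Site (F.P K) 0 → Matrix.specialUnitaryGroup (Fin 2) ℂ) U₀) ℓ)⁻¹) ^ 2)
            ≤ wilsonAction4 U - minActionRegPr F n K hnK.le e V := by
  obtain ⟨e₈, he₈, H⟩ := tubeGrowth_at_isCritR2_of_lift_of_hreg_five L h5
  obtain ⟨e₈', he₈', HL⟩ := symmetriesLift_at_critical_of_abelianMin_five L h5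
  obtain ⟨eπ, heπ, Hπ⟩ := exists_ePi L (by omega)
  refine ⟨min e₈ (min e₈' eπ), lt_min he₈ (lt_min he₈' heπ), ?_⟩
  intro F hF n K hnK hk γ b₀ p₀ e V a he hee hStab hloop hWreg hWmin U₀ δ hU₀reg hmin hreg
  obtain ⟨hr3, hr2, -⟩ := Hπ e he (hee.trans ((min_le_right _ _).trans (min_le_right _ _)))
  rw [← hF] at hr2
  have hcrit : IsCritR2 F n K hnK.le V U₀ :=
    isCritR2_of_isMinOn he hU₀reg (isMinOn_iff.mpr fun W hW => hmin.trans_le (minActionRegPr_le F hW))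
  have hlift := HL F hF n K hnK hk e V a he (hee.trans ((min_le_right _ _).trans (min_le_left _ _))) hr3 hr2 hStab hloop hWreg hWmin
    U₀ hU₀reg hcrit
  exact H F hF n K hnK γ b₀ p₀ e V U₀ δ he (hee.trans (min_le_left _ _)) hU₀reg hcrit hmin hlift hreg

end Tube

/-! ## §2 GAP♭ at the abelian stratum: with the tube-regularity row (uniform `γ*`), and from EX^{ab} ALONE (per-base-point `γ*`) -/

section Gap

/-- ★★★★ **GAP♭(V,U₀) AT PRINT'S REGULAR MINIMISER OVER AN ABELIAN DATUM ⟸ {EX^{ab}, `hreg`(δ)}, UNIFORMLY IN `γ ≤ γ*(L,b₀,p₀,δ)`.**  For every `L ≥ 5`, `b₀, p₀ > 0`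
and tube radius `δ > 0` there are `e₉ > 0` and `γ* > 0` such that at every member `(F, γ ≤ γ*, n < K)` with depth room `K − n ≤ m + K_P`, every `0 < e ≤ e₉`, every datum `V`
with constant σ₃-diagonal stabiliser, every abelian lettering `a` satisfying EX^{ab} (px12's letters VERBATIM), every good history `U₀ ∈ regFibrePr e V` realising `minActionRegPr e V`,
under `hreg`(δ): GAP♭(V,U₀) (the (T3) dock's text VERBATIM).  ✓FILE 1 `gapFlat_at_min_of_lift_of_hreg_five` ∘ ✓px12 `symmetriesLift_at_critical_of_abelianMin_five`.
[cite: Balaban1985Variational, (4)-(6) p.278, Thm 1 (8)-(10) p.279, Prop. 7 and (141)-(143) p.299; Balaban1985UV3, (12)-(13) p.259 and (18)-(22) p.260; Balaban1985RegularSpaces, Lemma 1 (1.24)-(1.26) p.79] -/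
theorem gapFlat_at_abelianMin_of_hreg_five (L : ℕ) (h5 : 5 ≤ L) (b₀ p₀ : ℝ) (hb : 0 < b₀) (hp : 0 < p₀) (δ : ℝ) (hδ : 0 < δ) :
    ∃ e₉ γs : ℝ, 0 < e₉ ∧ 0 < γs ∧
      ∀ (F : T3Family) (γ : ℝ), F.L = L → 0 < γ → γ ≤ γs → ∀ (n K : ℕ) (hnK : n < K), K - n ≤ (F.P K).m + (F.P K).K →
      ∀ (e : ℝ) (V : GaugeField (F.P n) 0 (Matrix.specialUnitaryGroup (Fin 2) ℂ)) (a : PBond (F.P K) 0 → ℝ),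
      0 < e → e ≤ e₉ →
      (∀ s : GaugeTransf (F.P n) 0 (Matrix.specialUnitaryGroup (Fin 2) ℂ), GaugeField.gaugeAct s V = V →
        ∃ c : Matrix.specialUnitaryGroup (Fin 2) ℂ, Commute ((c : Matrix.specialUnitaryGroup (Fin 2) ℂ) : Matrix (Fin 2) (Fin 2) ℂ) σ₃ ∧ s = fun _ => c) →
      (∀ s', s' < K - n → ∀ (c : PBond (F.P K) (s' + 1)) (i : Idx (F.P K)), 3 * |loopSum (linAvgIter s' a) c i| < 1) →
      gexpAt (suGroupModel 2) I_smul_sigma3_mem_lie a ∈ regFibrePr F n K hnK.le e V →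
      (∀ W' : GaugeField (F.P K) 0 (Matrix.specialUnitaryGroup (Fin 2) ℂ),
        (∀ b, Commute ((W' b : Matrix.specialUnitaryGroup (Fin 2) ℂ) : Matrix (Fin 2) (Fin 2) ℂ) σ₃) → W' ∈ regFibrePr F n K hnK.le e V →
          wilsonAction4 (gexpAt (suGroupModel 2) I_smul_sigma3_mem_lie a) ≤ wilsonAction4 W') →
      ∀ (U₀ : GaugeField (F.P K) 0 (Matrix.specialUnitaryGroup (Fin 2) ℂ)), U₀ ∈ regFibrePr F n K hnK.le e V →
        wilsonAction4 U₀ = minActionRegPr F n K hnK.le e V → U₀ ∈ histGood F ℰp (θBal F.L γ b₀ p₀) K n →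
        (∀ U ∈ closure (fibre F ℰp n K hnK.le V ∩ histGood F ℰp (θBal F.L γ b₀ p₀) K n),
            (∃ w : Site (F.P K) 0 → Matrix.specialUnitaryGroup (Fin 2) ℂ,
              (∀ U'' : GaugeField (F.P K) 0 (Matrix.specialUnitaryGroup (Fin 2) ℂ),
                  descendTo F ℰp n K hnK.le (GaugeField.gaugeAct w U'') = descendTo F ℰp n K hnK.le U'') ∧
                ∀ ℓ : PBond (F.P K) 0, dist1 (U ℓ * ((GaugeField.gaugeAct w U₀) ℓ)⁻¹) ≤ δ) →
            wilsonAction4 U ≤ minActionRegPr F n K hnK.le e V → U ∈ regFibrePr F n K hnK.le e V) →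
        ∃ μ : ℝ, 0 < μ ∧ ∀ U ∈ fibre F ℰp n K hnK.le V, U ∈ histGood F ℰp (θBal F.L γ b₀ p₀) K n →
          μ * ((F.L : ℝ)⁻¹) ^ (2 * (K - n)) *
              (⨅ w : {w : Site (F.P K) 0 → Matrix.specialUnitaryGroup (Fin 2) ℂ |
                  ∀ U : GaugeField (F.P K) 0 (Matrix.specialUnitaryGroup (Fin 2) ℂ),
                    descendTo F ℰp n K hnK.le (GaugeField.gaugeAct w U) = descendTo F ℰp n K hnK.le U},
                ∑ ℓ : PBond (F.P K) 0,
                  dist1 (U ℓ * ((GaugeField.gaugeAct (w : Site (F.P K) 0 → Matrix.specialUnitaryGroup (Fin 2) ℂ) U₀) ℓ)⁻¹) ^ 2)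
            ≤ wilsonAction4 U - minActionRegPr F n K hnK.le e V := by
  obtain ⟨e₈, γ₁, he₈, hγ₁, H⟩ := gapFlat_at_min_of_lift_of_hreg_five L h5 b₀ p₀ hb hp δ hδ
  obtain ⟨e₈', he₈', HL⟩ := symmetriesLift_at_critical_of_abelianMin_five L h5
  obtain ⟨eπ, heπ, Hπ⟩ := exists_ePi L (by omega)
  refine ⟨min e₈ (min e₈' eπ), γ₁, lt_min he₈ (lt_min he₈' heπ), hγ₁, ?_⟩
  intro F γ hF hγ hγle n K hnK hk e V a he hee hStab hloop hWreg hWmin U₀ hU₀reg hmin hU₀h hreg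
  obtain ⟨hr3, hr2, -⟩ := Hπ e he (hee.trans ((min_le_right _ _).trans (min_le_right _ _)))
  rw [← hF] at hr2
  have hcrit : IsCritR2 F n K hnK.le V U₀ :=
    isCritR2_of_isMinOn he hU₀reg (isMinOn_iff.mpr fun W hW => hmin.trans_le (minActionRegPr_le F hW))
  have hlift := HL F hF n K hnK hk e V a he (hee.trans ((min_le_right _ _).trans (min_le_left _ _))) hr3 hr2 hStab hloop hWreg hWmin
    U₀ hU₀reg hcrit
  exact H F γ hF hγ hγle n K hnK e V U₀ he (hee.trans (min_le_left _ _)) hU₀reg hmin hU₀h hlift hreg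

/-- ★★★★ **GAP♭(V,U₀) AT PRINT'S REGULAR MINIMISER OVER AN ABELIAN DATUM ⟸ EX^{ab} ALONE, for all `γ ≤ γ*(U₀)`.**  For every `L ≥ 5` and `b₀, p₀ > 0` there is `e₉ > 0` such
that at every member `(F, n < K)` with depth room `K − n ≤ m + K_P`, every `0 < e ≤ e₉`, every datum `V` with constant σ₃-diagonal stabiliser, every abelian lettering `a`
satisfying EX^{ab} (px12's letters VERBATIM) and every `U₀ ∈ regFibrePr e V` realising `minActionRegPr e V`, there is `γ* > 0` with: for every `0 < γ ≤ γ*` such that `U₀` is a good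
history, GAP♭(V,U₀) (VERBATIM).  ✓FILE 1 `gapFlat_at_min_of_lift_five` ∘ ✓px12 `symmetriesLift_at_critical_of_abelianMin_five`.  NO per-datum letter besides EX^{ab} (and `hStab`, which
NAMES the stratum); the price is the per-base-point `γ*` — NOT the organ's datum-free order (TUBE-REG∘ ∕ GAP♯∘ stay open).
[cite: Balaban1985Variational, (4)-(6) p.278, Thm 1 (8)-(10) p.279, Prop. 7 and (141)-(143) p.299; Balaban1985UV3, (12)-(13) p.259 and (18)-(22) p.260; Balaban1985RegularSpaces, Lemma 1 (1.24)-(1.26) p.79] -/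
theorem gapFlat_at_abelianMin_five (L : ℕ) (h5 : 5 ≤ L) (b₀ p₀ : ℝ) (hb : 0 < b₀) (hp : 0 < p₀) :
    ∃ e₉ : ℝ, 0 < e₉ ∧ ∀ (F : T3Family), F.L = L → ∀ (n K : ℕ) (hnK : n < K), K - n ≤ (F.P K).m + (F.P K).K →
      ∀ (e : ℝ) (V : GaugeField (F.P n) 0 (Matrix.specialUnitaryGroup (Fin 2) ℂ)) (a : PBond (F.P K) 0 → ℝ),
      0 < e → e ≤ e₉ →
      (∀ s : GaugeTransf (F.P n) 0 (Matrix.specialUnitaryGroup (Fin 2) ℂ), GaugeField.gaugeAct s V = V →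
        ∃ c : Matrix.specialUnitaryGroup (Fin 2) ℂ, Commute ((c : Matrix.specialUnitaryGroup (Fin 2) ℂ) : Matrix (Fin 2) (Fin 2) ℂ) σ₃ ∧ s = fun _ => c) →
      (∀ s', s' < K - n → ∀ (c : PBond (F.P K) (s' + 1)) (i : Idx (F.P K)), 3 * |loopSum (linAvgIter s' a) c i| < 1) →
      gexpAt (suGroupModel 2) I_smul_sigma3_mem_lie a ∈ regFibrePr F n K hnK.le e V →
      (∀ W' : GaugeField (F.P K) 0 (Matrix.specialUnitaryGroup (Fin 2) ℂ),
        (∀ b, Commute ((W' b : Matrix.specialUnitaryGroup (Fin 2) ℂ) : Matrix (Fin 2) (Fin 2) ℂ) σ₃) → W' ∈ regFibrePr F n K hnK.le e V →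
          wilsonAction4 (gexpAt (suGroupModel 2) I_smul_sigma3_mem_lie a) ≤ wilsonAction4 W') →
      ∀ (U₀ : GaugeField (F.P K) 0 (Matrix.specialUnitaryGroup (Fin 2) ℂ)), U₀ ∈ regFibrePr F n K hnK.le e V →
        wilsonAction4 U₀ = minActionRegPr F n K hnK.le e V →
        ∃ γs : ℝ, 0 < γs ∧ ∀ (γ : ℝ), 0 < γ → γ ≤ γs → U₀ ∈ histGood F ℰp (θBal F.L γ b₀ p₀) K n →
        ∃ μ : ℝ, 0 < μ ∧ ∀ U ∈ fibre F ℰp n K hnK.le V, U ∈ histGood F ℰp (θBal F.L γ b₀ p₀) K n →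
          μ * ((F.L : ℝ)⁻¹) ^ (2 * (K - n)) *
              (⨅ w : {w : Site (F.P K) 0 → Matrix.specialUnitaryGroup (Fin 2) ℂ |
                  ∀ U : GaugeField (F.P K) 0 (Matrix.specialUnitaryGroup (Fin 2) ℂ),
                    descendTo F ℰp n K hnK.le (GaugeField.gaugeAct w U) = descendTo F ℰp n K hnK.le U},
                ∑ ℓ : PBond (F.P K) 0,
                  dist1 (U ℓ * ((GaugeField.gaugeAct (w : Site (F.P K) 0 → Matrix.specialUnitaryGroup (Fin 2) ℂ) U₀) ℓ)⁻¹) ^ 2)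
            ≤ wilsonAction4 U - minActionRegPr F n K hnK.le e V := by
  obtain ⟨e₈, he₈, H⟩ := gapFlat_at_min_of_lift_five L h5 b₀ p₀ hb hp
  obtain ⟨e₈', he₈', HL⟩ := symmetriesLift_at_critical_of_abelianMin_five L h5
  obtain ⟨eπ, heπ, Hπ⟩ := exists_ePi L (by omega)
  refine ⟨min e₈ (min e₈' eπ), lt_min he₈ (lt_min he₈' heπ), ?_⟩
  intro F hF n K hnK hk e V a he hee hStab hloop hWreg hWmin U₀ hU₀reg hmin
  obtain ⟨hr3, hr2, -⟩ := Hπ e he (hee.trans ((min_le_right _ _).trans (min_le_right _ _)))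
  rw [← hF] at hr2
  have hcrit : IsCritR2 F n K hnK.le V U₀ :=
    isCritR2_of_isMinOn he hU₀reg (isMinOn_iff.mpr fun W hW => hmin.trans_le (minActionRegPr_le F hW))
  have hlift := HL F hF n K hnK hk e V a he (hee.trans ((min_le_right _ _).trans (min_le_left _ _))) hr3 hr2 hStab hloop hWreg hWmin
    U₀ hU₀reg hcrit
  exact H F hF n K hnK e V U₀ he (hee.trans (min_le_left _ _)) hU₀reg hmin hlift

end Gap

end Summit.QuantumFields.YangMills.Theorems.FluctuationComparisonRegPrIntLS2BetaGapFlatAtAbelian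

end
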